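import Literature.Geometry.Symplectic.JHolomorphicLocalIntersections
import Literature.Geometry.Symplectic.JHolomorphicUniqueContinuationChart
import Literature.Geometry.Symplectic.JHolomorphicChartLocalisation
import Literature.Geometry.Symplectic.JHolomorphicWeierstrass
import Mathlib.Geometry.Manifold.IsManifold.ExtChartAt
import Mathlib.Topology.UniformSpace.Compact
import Mathlib.Topology.UniformSpace.HeineCantor
import Mathlib.Topology.UniformSpace.UniformConvergenceTopology

/-!
# Towards the discharge of `jHolomorphic_immersed_of_limitEmbedded_punctured`: the elementary steps

Sibling "Proofs" file of `JHolomorphicLocalIntersections.lean`. The named fact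
`Literature.Geometry.Symplectic.jHolomorphic_immersed_of_limitEmbedded_punctured` (no cusps in
`C⁰`-limits of embedded `J`-curves: D. McDuff, *The local behaviour of holomorphic curves in almost
complex 4-manifolds*, J. Differential Geom. 34 (1991), Thm 1.4, Cor. 4.4, Lemma 4.3, Lemma 4.2(i),
with C. Hummel (1997), Ch. III Prop. 3.1 for `C⁰ ⇒ C¹`) is NOT discharged in this file. Its published
proof has the following architecture (McDuff 1991, §4 and (5.5)–(5.6)):

1. a point `z` of a `J`-holomorphic curve `G` is critical iff `dG(z) = 0`, because `dG(z)` is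
   complex-linear `(ℂ, i) → (T_{G z} V, J)` and therefore injective or zero;
2. localise into one chart of `V` around `G 0`: the `C⁰`-convergence `uₙ → G`, expressed through
   the auxiliary topological embedding `ι : V → ℝᴺ`, forces `uₙ(D̄_{ρ'}) ⊂` chart domain for all
   large `n` and gives uniform convergence of the chart expressions on `D̄_{ρ'}`;
3. interior elliptic regularity upgrades `C⁰`- to `C¹`-convergence on a smaller closed disc `D`
   (Hummel 1997, Ch. III Prop. 3.1; in the tree the named fact `JHolomorphicWeierstrassR4`, flat
   `ℝ⁴` form, undischarged);
4. McDuff's local self-intersection number: `L.Int(G, 0) > 0` at a critical point of an injective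
   germ (Thm 1.4, via the normal form Prop. 2.6 and the desingularisations of §3), `Int(f') =
   L.Int(G, 0)` for every `J`-holomorphic immersion `f'` sufficiently `C¹`-close to `G|D` (Cor. 4.4,
   Lemma 4.3, Lemma 4.2(ii)), and `Int(f') = #{double points}` for an immersion with transverse
   double points, `= 0` for an embedding (Lemma 4.2(i), Def. 4.1: Chern number of the bundle over
   `S²` glued along a boundary trivialisation) — so the embeddings `uₙ|D`, `n ≫ 0`, cannot be
   `C¹`-close to `G|D`: contradiction.

This file PROVES steps 1 and 2, in the generality in which the facts of the sibling file
(`jHolomorphic_isolatedIntersection_persists`, `jHolomorphic_immersed_of_limitEmbedded_punctured`)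
and `jHolomorphicLimitOfEmbedded_isEmbedded` state their hypotheses, so that a discharge of any of
them can start from `dG(0) = 0` and from chart-level uniform convergence:

* `injective_or_eq_zero_of_map_I_mul`, `IsJHolomorphic.mfderiv_injective_or_eq_zero`,
  `IsJHolomorphic.mfderiv_eq_zero_of_not_injective`,
  `IsJHolomorphic.injective_mfderiv_iff_ne_zero` (step 1; compare the pointwise forms
  `IsJHolomorphic.mfderiv_apply_eq` in `JHolomorphicReparametrisation.lean` and
  `IsJHolomorphicOn.mfderiv_eq_zero_of_apply_one_eq_zero` in `JHolomorphicOn.lean`, which express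
  that `du_z` is determined by `du_z 1`);
* `eventually_mapsTo_of_tendstoUniformlyOn_comp` (the maps `uₙ` eventually take a set `S` into any
  open set containing a compact set containing `G(S)`),
  `tendstoUniformlyOn_comp_of_isEmbedding` (uniform convergence through the embedding `ι`
  transfers to uniform convergence through any map continuous on a compact set containing all the
  images, e.g. a chart), `exists_closedBall_tendstoUniformlyOn_extChartAt` (both combined: a closed
  disc about `0` mapped into the chart at `G 0` by `G` and eventually by the `uₙ`, with uniformly
  convergent chart expressions), and its specialisation `exists_closedBall_tendstoUniformlyOn_euclid`
  to the exact hypotheses of the facts (`V` a `4`-manifold, `ι : V → ℝᴺ`) (step 2).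

It then carries out step 3 MODULO the named fact `JHolomorphicWeierstrassR4` (taken as a hypothesis
`hW`, to be fed `JHolomorphicWeierstrassR4_holds` once that fact is discharged in Literature):

* `exists_flatCuspData_of_mfderiv_eq_zero` — if moreover `dG(0) = 0`, the chart expressions
  `f = φ ∘ G`, `f'ₙ = φ ∘ u_{n+n₀}` (`φ = extChartAt (𝓡 4) (G 0)`) form, on a disc `ball 0 R`, the
  configuration of McDuff's Cor. 4.4 / (5.6): a global smooth almost complex structure `J'` on
  `ℝ⁴` (the coordinate structure of the chart, globalised by a cut-off:
  `ChartLocalisation.exists_chartJ`, `ChartLocalisation.exists_contDiff_sq_neg_eqOn_ball`), `f`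
  smooth, `J'`-holomorphic, injective, immersive off `0`, `df(0) = 0`, and smooth
  `J'`-holomorphic injective immersions `f'ₙ → f` uniformly with `df'ₙ → df` locally uniformly
  (`hW` on the open disc);
* `jHolomorphic_immersed_of_limitEmbedded_punctured_of_flat` — the named fact follows from `hW`
  and the flat `C¹` statement of step 4 (McDuff (5.6) p. 163 with Cor. 4.4, Thm 1.4,
  Lemma 4.2(i): a `J'`-holomorphic immersion `C¹`-close on a closed disc to a `J'`-holomorphic
  embedding-except-at-the-critical-point-`0` is not injective), the latter taken as an explicit
  hypothesis: McDuff's self-intersection number `Int` (Def. 4.1) and its properties are not yet in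
  the tree, and no named fact is introduced for them here.

Step 4 is the remaining Literature debt recorded in the module docstring of the facts file.

## References

* D. McDuff, *The local behaviour of holomorphic curves in almost complex 4-manifolds*,
  J. Differential Geom. 34 (1991) 143–164: §1 p. 144 ("`x` is said to be critical if it is the image
  of a point `z` such that `df_z = 0`"), §4 (Def. 4.1, Lemmas 4.2, 4.3, Cor. 4.4), §5 ((5.5), (5.6),
  Lemma 5.3). [McDuff1991LocalBehaviour]
* C. Hummel, *Gromov's compactness theorem for pseudo-holomorphic curves*, Progress in Math. 151
  (1997), Ch. III Prop. 3.1. [Hummel1997]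
-/

noncomputable section

open scoped Manifold ContDiff
open Set Filter Function _root_.Topology

namespace Literature.Geometry.Symplectic

/-! ### Step 1: the differential of a `J`-holomorphic curve is injective or zero -/

section ComplexLinearity

/-- A real-linear map `L : ℂ → F` which intertwines multiplication by `i` with SOME continuous
linear endomorphism `A` of `F` (`L (i ζ) = A (L ζ)`; for the differential of a `J`-holomorphic
curve, `A = J_{u z}`) is injective or zero: its kernel is a real subspace of `ℂ` stable under `i`,
hence `0` or all of `ℂ` (McDuff 1991, §1 p. 144: critical points are the points with `df_z = 0`).
[folklore] -/
theorem injective_or_eq_zero_of_map_I_mul {F : Type*} [TopologicalSpace F] [AddCommGroup F]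
    [Module ℝ F] (L : ℂ →L[ℝ] F) (A : F →L[ℝ] F)
    (hL : ∀ ζ : ℂ, L (Complex.I * ζ) = A (L ζ)) : Injective L ∨ L = 0 := by
  by_cases h : ∃ ζ₀ : ℂ, ζ₀ ≠ 0 ∧ L ζ₀ = 0
  · obtain ⟨ζ₀, hζ₀, hL0⟩ := h
    refine Or.inr (ContinuousLinearMap.ext fun ζ => ?_)
    -- decompose `ζ = a ζ₀ + b (i ζ₀)` over `ℝ`, `a + b i = ζ / ζ₀`
    have h1 : ζ / ζ₀ * ζ₀ = ζ := by field_simp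
    have hdec : ζ = ((ζ / ζ₀).re : ℝ) • ζ₀ + ((ζ / ζ₀).im : ℝ) • (Complex.I * ζ₀) := by
      simp only [Complex.real_smul]
      conv_lhs => rw [← h1, ← Complex.re_add_im (ζ / ζ₀)]
      ring
    rw [hdec, map_add, map_smul, map_smul, hL, hL0, map_zero, smul_zero, smul_zero, add_zero]
    simp
  · push Not at h
    refine Or.inl fun ζ ζ' hζ => ?_
    by_contra hne
    exact h (ζ - ζ') (sub_ne_zero.mpr hne) (by rw [map_sub, hζ, sub_self])

variable {E : Type*} [NormedAddCommGroup E] [NormedSpace ℝ E] {H : Type*} [TopologicalSpace H]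
  {I : ModelWithCorners ℝ E H} {M : Type*} [TopologicalSpace M] [ChartedSpace H M]

/-- **The differential of a `J`-holomorphic curve is injective or zero.** For `u : ℂ → M`
`J`-holomorphic (`du(z)(i ζ) = J_{u z} (du(z) ζ)`, any family `J` of endomorphisms) and any `z`,
`du(z) = mfderiv 𝓘(ℝ, ℂ) I u z` is injective or `0`; so "regular at `z`" (`du(z)` injective, the
phrasing of the facts of `JHolomorphicLocalIntersections.lean`) is the negation of "critical at `z`"
(`du(z) = 0`, McDuff 1991 §1 p. 144). [folklore] -/
theorem IsJHolomorphic.mfderiv_injective_or_eq_zero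
    {J : ∀ x : M, TangentSpace I x →L[ℝ] TangentSpace I x} {u : ℂ → M}
    (hu : IsJHolomorphic I J u) (z : ℂ) :
    Injective (mfderiv 𝓘(ℝ, ℂ) I u z) ∨ mfderiv 𝓘(ℝ, ℂ) I u z = 0 :=
  injective_or_eq_zero_of_map_I_mul (mfderiv 𝓘(ℝ, ℂ) I u z) (J (u z)) (hu z)

/-- A non-regular point of a `J`-holomorphic curve is critical: `du(z) = 0`. [folklore] -/
theorem IsJHolomorphic.mfderiv_eq_zero_of_not_injective
    {J : ∀ x : M, TangentSpace I x →L[ℝ] TangentSpace I x} {u : ℂ → M}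
    (hu : IsJHolomorphic I J u) {z : ℂ} (hz : ¬ Injective (mfderiv 𝓘(ℝ, ℂ) I u z)) :
    mfderiv 𝓘(ℝ, ℂ) I u z = 0 :=
  (hu.mfderiv_injective_or_eq_zero z).resolve_left hz

/-- For a `J`-holomorphic curve, `du(z)` is injective iff `du(z) ≠ 0`. [folklore] -/
theorem IsJHolomorphic.injective_mfderiv_iff_ne_zero
    {J : ∀ x : M, TangentSpace I x →L[ℝ] TangentSpace I x} {u : ℂ → M}
    (hu : IsJHolomorphic I J u) (z : ℂ) :
    Injective (mfderiv 𝓘(ℝ, ℂ) I u z) ↔ mfderiv 𝓘(ℝ, ℂ) I u z ≠ 0 := by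
  refine ⟨fun h h0 => ?_, fun h => (hu.mfderiv_injective_or_eq_zero z).resolve_right h⟩
  have h10 : mfderiv 𝓘(ℝ, ℂ) I u z (1 : ℂ) = mfderiv 𝓘(ℝ, ℂ) I u z (0 : ℂ) := by
    rw [h0]; rfl
  have h11 : (1 : ℂ) = 0 := h h10
  exact one_ne_zero h11

end ComplexLinearity

/-! ### Step 2: localisation of `C⁰`-convergence expressed through an embedding -/

section Localisation

variable {α V X : Type*} [TopologicalSpace V] [UniformSpace X] {e : V → X}
  {κ : Type*} {p : Filter κ} {F : κ → α → V} {f : α → V} {S : Set α}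

/-- If `e ∘ Fₙ → e ∘ f` uniformly on `S` along a filter, for a topological embedding `e : V → X`
into a uniform space, and `f(S)` lies in a compact `K` contained in an open `W`, then eventually
`Fₙ(S) ⊆ W`. (Lebesgue-number lemma in `X` for the compact `e(K)` inside an open `O` with
`e⁻¹(O) = W`.) [folklore] -/
theorem eventually_mapsTo_of_tendstoUniformlyOn_comp (he : IsEmbedding e)
    (h : TendstoUniformlyOn (fun n z => e (F n z)) (fun z => e (f z)) p S)
    {K : Set V} (hK : IsCompact K) (hfK : MapsTo f S K) {W : Set V} (hW : IsOpen W)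
    (hKW : K ⊆ W) : ∀ᶠ n in p, MapsTo (F n) S W := by
  obtain ⟨O, hO, hOW⟩ := he.isInducing.isOpen_iff.1 hW
  have hKO : e '' K ⊆ O := by
    rintro _ ⟨v, hv, rfl⟩
    have hv' : v ∈ e ⁻¹' O := by rw [hOW]; exact hKW hv
    exact hv'
  obtain ⟨U, hU, -, hball⟩ := lebesgue_number_of_compact_open (hK.image he.continuous) hO hKO
  filter_upwards [h U hU] with n hn z hz
  have h1 : e (F n z) ∈ O := hball (e (f z)) (mem_image_of_mem e (hfK hz)) (hn z hz)
  have h2 : F n z ∈ e ⁻¹' O := h1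
  rwa [hOW] at h2

/-- **Uniform convergence through an embedding transfers to uniform convergence through any map
continuous on a compact set containing the images.** If `e ∘ Fₙ → e ∘ f` uniformly on `S`
(`e : V → X` a topological embedding into a uniform space), `K ⊆ V` is compact, `f(S) ⊆ K` and
eventually `Fₙ(S) ⊆ K`, then `φ ∘ Fₙ → φ ∘ f` uniformly on `S` for every `φ` continuous on `K`
(with values in any uniform space): `φ ∘ e⁻¹` is uniformly continuous on the compact `e(K)`
(Heine–Cantor). Typically `φ` is a chart of the manifold `V`. [folklore] -/
theorem tendstoUniformlyOn_comp_of_isEmbedding {Y : Type*} [UniformSpace Y] (he : IsEmbedding e)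
    (h : TendstoUniformlyOn (fun n z => e (F n z)) (fun z => e (f z)) p S)
    {K : Set V} (hK : IsCompact K) (hFK : ∀ᶠ n in p, MapsTo (F n) S K) (hfK : MapsTo f S K)
    {φ : V → Y} (hφ : ContinuousOn φ K) :
    TendstoUniformlyOn (fun n z => φ (F n z)) (fun z => φ (f z)) p S := by
  classical
  rcases S.eq_empty_or_nonempty with rfl | ⟨z₀, hz₀⟩
  · exact tendstoUniformlyOn_empty
  haveI : Nonempty V := ⟨f z₀⟩
  -- `g = φ ∘ e⁻¹` on `e '' K`
  set g : X → Y := fun x => φ (invFunOn e K x) with hg_def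
  have hg : ∀ v ∈ K, g (e v) = φ v := by
    intro v hv
    have h1 : e (invFunOn e K (e v)) = e v := invFunOn_eq ⟨v, hv, rfl⟩
    simp only [hg_def, he.injective h1]
  -- `g` is continuous on the compact `e '' K`, hence uniformly continuous there
  have hgc : ContinuousOn g (e '' K) := by
    rintro _ ⟨v, hv, rfl⟩
    have h2 : (g ∘ e) =ᶠ[𝓝[K] v] φ :=
      (eventually_mem_nhdsWithin (a := v) (s := K)).mono fun w hw => hg w hw
    have h3 : Tendsto (g ∘ e) (𝓝[K] v) (𝓝 (g (e v))) := by
      rw [hg v hv]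
      exact (hφ v hv).congr' h2.symm
    show Tendsto g (𝓝[e '' K] (e v)) (𝓝 (g (e v)))
    rw [← he.map_nhdsWithin_eq]
    exact tendsto_map' h3
  have hgu : UniformContinuousOn g (e '' K) :=
    (hK.image he.continuous).uniformContinuousOn_of_continuous hgc
  have hF' : ∀ᶠ n in p, ∀ z ∈ S, e (F n z) ∈ e '' K :=
    hFK.mono fun n hn z hz => mem_image_of_mem e (hn hz)
  have hf' : ∀ z ∈ S, e (f z) ∈ e '' K := fun z hz => mem_image_of_mem e (hfK hz)
  have key := UniformContinuousOn.comp_tendstoUniformlyOn_eventually hF' hf' hgu h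
  refine (key.congr ?_).congr_right ?_
  · exact hFK.mono fun n hn z hz => hg _ (hn hz)
  · exact fun z hz => hg _ (hfK hz)

variable {E' : Type*} [NormedAddCommGroup E'] [NormedSpace ℝ E'] {H' : Type*}
  [TopologicalSpace H'] (I' : ModelWithCorners ℝ E' H') [ChartedSpace H' V]

/-- **Localisation into a chart.** Let `V` be a (locally compact) charted space, `e : V → X` a
topological embedding into a uniform space, `G : ℂ → V` continuous and `uₙ : ℂ → V` with
`e ∘ uₙ → e ∘ G` uniformly on `closedBall 0 ρ`, `ρ > 0`. Then for some `0 < ρ' ≤ ρ`, `G` maps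
`closedBall 0 ρ'` into the source of the extended chart at `G 0`, so does `uₙ` for all large `n`,
and the chart expressions converge uniformly on `closedBall 0 ρ'`:
`extChartAt (G 0) ∘ uₙ → extChartAt (G 0) ∘ G`. (For a manifold modelled on a finite-dimensional
space, local compactness is `ChartedSpace.locallyCompactSpace`.) [folklore] -/
theorem exists_closedBall_tendstoUniformlyOn_extChartAt [LocallyCompactSpace V]
    (he : IsEmbedding e) {u : κ → ℂ → V} {G : ℂ → V} (hG : Continuous G) {ρ : ℝ} (hρ : 0 < ρ)
    (h : TendstoUniformlyOn (fun n z => e (u n z)) (fun z => e (G z)) p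
      (Metric.closedBall (0 : ℂ) ρ)) :
    ∃ ρ' : ℝ, 0 < ρ' ∧ ρ' ≤ ρ ∧
      MapsTo G (Metric.closedBall (0 : ℂ) ρ') (extChartAt I' (G 0)).source ∧
      (∀ᶠ n in p, MapsTo (u n) (Metric.closedBall (0 : ℂ) ρ') (extChartAt I' (G 0)).source) ∧
      TendstoUniformlyOn (fun n z => extChartAt I' (G 0) (u n z))
        (fun z => extChartAt I' (G 0) (G z)) p (Metric.closedBall (0 : ℂ) ρ') := by
  -- a compact neighbourhood `K` of `G 0` inside the chart source
  obtain ⟨K, hKnhds, hKsrc, hK⟩ := local_compact_nhds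
    ((isOpen_extChartAt_source (I := I') (G 0)).mem_nhds (mem_extChartAt_source (I := I') (G 0)))
  -- a closed disc mapped by `G` into `interior K`
  have h0 : G ⁻¹' interior K ∈ 𝓝 (0 : ℂ) :=
    hG.continuousAt.preimage_mem_nhds (interior_mem_nhds.2 hKnhds)
  obtain ⟨ρ₁, hρ₁, hball⟩ := Metric.nhds_basis_closedBall.mem_iff.1 h0
  set ρ' := min ρ₁ ρ with hρ'_def
  have hS : MapsTo G (Metric.closedBall (0 : ℂ) ρ') (interior K) := fun z hz =>
    hball (Metric.closedBall_subset_closedBall (min_le_left _ _) hz)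
  have h' := h.mono (Metric.closedBall_subset_closedBall (min_le_right ρ₁ ρ))
  -- eventually the `uₙ` map the disc into `interior K ⊆ K ⊆ source`
  have hev : ∀ᶠ n in p, MapsTo (u n) (Metric.closedBall (0 : ℂ) ρ') (interior K) :=
    eventually_mapsTo_of_tendstoUniformlyOn_comp he h' ((isCompact_closedBall 0 ρ').image hG)
      (mapsTo_image G _) isOpen_interior hS.image_subset
  have hevK : ∀ᶠ n in p, MapsTo (u n) (Metric.closedBall (0 : ℂ) ρ') K :=
    hev.mono fun n hn => hn.mono_right interior_subset
  refine ⟨ρ', lt_min hρ₁ hρ, min_le_right _ _, (hS.mono_right interior_subset).mono_right hKsrc,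
    hevK.mono fun n hn => hn.mono_right hKsrc, ?_⟩
  exact tendstoUniformlyOn_comp_of_isEmbedding he h' hK hevK (hS.mono_right interior_subset)
    ((continuousOn_extChartAt (I := I') (G 0)).mono hKsrc)

/-- **Localisation into a chart, in the exact setting of the facts of
`JHolomorphicLocalIntersections.lean`**: `V` a manifold charted on `ℝ⁴ = EuclideanSpace ℝ (Fin 4)`,
`ι : V → ℝᴺ` a topological embedding, `G : ℂ → V` continuous, `ι ∘ uₙ → ι ∘ G` uniformly on
`closedBall 0 ρ`. Conclusion as in `exists_closedBall_tendstoUniformlyOn_extChartAt` for the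
extended chart `extChartAt (𝓡 4) (G 0)`. [folklore] -/
theorem exists_closedBall_tendstoUniformlyOn_euclid {V : Type*} [TopologicalSpace V]
    [ChartedSpace (EuclideanSpace ℝ (Fin 4)) V] {N : ℕ} {ι : V → EuclideanSpace ℝ (Fin N)}
    (hι : IsEmbedding ι) {u : ℕ → ℂ → V} {G : ℂ → V} (hG : Continuous G) {ρ : ℝ} (hρ : 0 < ρ)
    (h : TendstoUniformlyOn (fun n z => ι (u n z)) (fun z => ι (G z)) atTop
      (Metric.closedBall (0 : ℂ) ρ)) :
    ∃ ρ' : ℝ, 0 < ρ' ∧ ρ' ≤ ρ ∧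
      MapsTo G (Metric.closedBall (0 : ℂ) ρ') (extChartAt (𝓡 4) (G 0)).source ∧
      (∀ᶠ n in atTop, MapsTo (u n) (Metric.closedBall (0 : ℂ) ρ') (extChartAt (𝓡 4) (G 0)).source) ∧
      TendstoUniformlyOn (fun n z => extChartAt (𝓡 4) (G 0) (u n z))
        (fun z => extChartAt (𝓡 4) (G 0) (G z)) atTop (Metric.closedBall (0 : ℂ) ρ') := by
  haveI : LocallyCompactSpace V := ChartedSpace.locallyCompactSpace (EuclideanSpace ℝ (Fin 4)) V
  exact exists_closedBall_tendstoUniformlyOn_extChartAt (𝓡 4) hι hG hρ h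

end Localisation

/-! ### Step 3: the flat `C¹` cusp data (chart package + interior regularity) -/

section FlatCuspData

open Metric

/-- Re-indexing a uniformly convergent family along a map of index filters (e.g. shifting a
sequence: `g = (· + n₀)`, `tendsto_add_atTop_nat`). [folklore] -/
theorem TendstoUniformlyOn.comp_tendsto_index {α β κ κ' : Type*} [UniformSpace β]
    {F : κ → α → β} {f : α → β} {p : Filter κ} {p' : Filter κ'} {s : Set α}
    (h : TendstoUniformlyOn F f p s) {g : κ' → κ} (hg : Tendsto g p' p) :
    TendstoUniformlyOn (fun k => F (g k)) f p' s :=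
  fun U hU => hg.eventually (h U hU)

/-- **The flat `C¹` cusp data of a non-immersed limit of embedded `J`-curves.** In the setting of
`jHolomorphic_immersed_of_limitEmbedded_punctured` (smooth almost complex `4`-manifold `(V, J)`,
`G : ℂ → V` smooth `J`-holomorphic, injective on `ball 0 ρ` and immersive on the punctured disc,
smooth `J`-holomorphic injective immersions `uₙ → G` uniformly on `closedBall 0 ρ` through a
topological embedding `ι : V → ℝᴺ`), suppose moreover `dG(0) = 0` and assume the interior
regularity fact `JHolomorphicWeierstrassR4` (Hummel 1997, III.3.1). Then, reading everything in
the chart `φ = extChartAt (𝓡 4) (G 0)` — `f = φ ∘ G`, `f'ₙ = φ ∘ u_{n+n₀}` — one obtains on some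
disc `ball 0 R`, `R ≤ ρ`, exactly the configuration of McDuff 1991, Cor. 4.4 / (5.6): a GLOBAL
smooth almost complex structure `J'` on `ℝ⁴` (`J'² = -1`; the coordinate structure of the chart,
globalised by a cut-off, `ChartLocalisation.exists_chartJ`,
`ChartLocalisation.exists_contDiff_sq_neg_eqOn_ball`), `f` smooth and `J'`-holomorphic on the
disc, injective there, immersive off `0`, with `df(0) = 0` (a critical point, McDuff p. 144), and
smooth `J'`-holomorphic INJECTIVE immersions `f'ₙ` of the disc converging to `f` uniformly
together with their first derivatives locally uniformly (the `C⁰ ⇒ C¹` upgrade is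
`JHolomorphicWeierstrassR4` applied on the open disc). Steps 2–3 of the published proof of
`jHolomorphic_immersed_of_limitEmbedded_punctured` (module docstring); step 4 (McDuff's
`Int`/`L.Int` theory) is what turns this data into a contradiction.
[cite: McDuff1991LocalBehaviour, (5.6) p. 163 with Cor. 4.4; Hummel1997, Ch. III Prop. 3.1] -/
theorem exists_flatCuspData_of_mfderiv_eq_zero (hW : JHolomorphicWeierstrassR4)
    {V : Type*} [TopologicalSpace V] [ChartedSpace (EuclideanSpace ℝ (Fin 4)) V]
    [IsManifold (𝓡 4) ∞ V]
    {J : ∀ x : V, TangentSpace (𝓡 4) x →L[ℝ] TangentSpace (𝓡 4) x}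
    (hJ2 : ∀ (x : V) (v : TangentSpace (𝓡 4) x), J x (J x v) = -v)
    (hJsm : ∀ x₀ : V, ContMDiffAt (𝓡 4)
      𝓘(ℝ, EuclideanSpace ℝ (Fin 4) →L[ℝ] EuclideanSpace ℝ (Fin 4)) ∞
      (inTangentCoordinates (𝓡 4) (𝓡 4) (id : V → V) id (fun x => J x) x₀) x₀)
    {N : ℕ} {ι : V → EuclideanSpace ℝ (Fin N)} (hι : IsEmbedding ι)
    {G : ℂ → V} (hG : ContMDiff 𝓘(ℝ, ℂ) (𝓡 4) ∞ G) (hGJ : IsJHolomorphic (𝓡 4) J G)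
    {ρ : ℝ} (hρ : 0 < ρ) (hGinj : InjOn G (ball (0 : ℂ) ρ))
    (hGimm : ∀ z ∈ ball (0 : ℂ) ρ, z ≠ 0 → Injective (mfderiv 𝓘(ℝ, ℂ) (𝓡 4) G z))
    (h0 : mfderiv 𝓘(ℝ, ℂ) (𝓡 4) G 0 = 0)
    {u : ℕ → ℂ → V} (hu : ∀ n, ContMDiff 𝓘(ℝ, ℂ) (𝓡 4) ∞ (u n))
    (huJ : ∀ n, IsJHolomorphic (𝓡 4) J (u n)) (huinj : ∀ n, Injective (u n))
    (huimm : ∀ n (z : ℂ), Injective (mfderiv 𝓘(ℝ, ℂ) (𝓡 4) (u n) z))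
    (hlim : TendstoUniformlyOn (fun n z => ι (u n z)) (fun z => ι (G z)) atTop
      (closedBall (0 : ℂ) ρ)) :
    ∃ (J' : EuclideanSpace ℝ (Fin 4) → EuclideanSpace ℝ (Fin 4) →L[ℝ] EuclideanSpace ℝ (Fin 4))
      (f : ℂ → EuclideanSpace ℝ (Fin 4)) (f' : ℕ → ℂ → EuclideanSpace ℝ (Fin 4)) (R : ℝ) (n₀ : ℕ),
      (f = fun z => extChartAt (𝓡 4) (G 0) (G z)) ∧
      (∀ n z, f' n z = extChartAt (𝓡 4) (G 0) (u (n + n₀) z)) ∧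
      ContDiff ℝ ∞ J' ∧ (∀ x v, J' x (J' x v) = -v) ∧ 0 < R ∧ R ≤ ρ ∧
      MapsTo G (ball (0 : ℂ) R) (chartAt (EuclideanSpace ℝ (Fin 4)) (G 0)).source ∧
      (∀ n, MapsTo (u (n + n₀)) (ball (0 : ℂ) R)
        (chartAt (EuclideanSpace ℝ (Fin 4)) (G 0)).source) ∧
      ContDiffOn ℝ ∞ f (ball 0 R) ∧
      (∀ z ∈ ball (0 : ℂ) R, ∀ ζ : ℂ,
        fderiv ℝ f z (Complex.I * ζ) = J' (f z) (fderiv ℝ f z ζ)) ∧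
      InjOn f (ball 0 R) ∧
      (∀ z ∈ ball (0 : ℂ) R, z ≠ 0 → Injective (fderiv ℝ f z)) ∧
      fderiv ℝ f 0 = 0 ∧
      (∀ n, ContDiffOn ℝ ∞ (f' n) (ball 0 R)) ∧
      (∀ n, ∀ z ∈ ball (0 : ℂ) R, ∀ ζ : ℂ,
        fderiv ℝ (f' n) z (Complex.I * ζ) = J' (f' n z) (fderiv ℝ (f' n) z ζ)) ∧
      (∀ n, ∀ z ∈ ball (0 : ℂ) R, Injective (fderiv ℝ (f' n) z)) ∧
      (∀ n, InjOn (f' n) (ball 0 R)) ∧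
      TendstoUniformlyOn f' f atTop (ball 0 R) ∧
      TendstoLocallyUniformlyOn (fun n => fderiv ℝ (f' n)) (fderiv ℝ f) atTop (ball 0 R) := by
  -- ### the coordinate almost complex structure of the chart at `G 0`, globalised
  obtain ⟨Jc, hJc, hJc2, hJcE⟩ := ChartLocalisation.exists_chartJ J hJ2 hJsm (G 0)
  obtain ⟨J', hJ', hJ'2, rJ, hrJ, -, hJ'c⟩ :=
    ChartLocalisation.exists_contDiff_sq_neg_eqOn_ball (isOpen_extChartAt_target (I := 𝓡 4) (G 0))
      hJc hJc2 (mem_extChartAt_target (I := 𝓡 4) (G 0))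
  have hJ'E : ∀ x ∈ (chartAt (EuclideanSpace ℝ (Fin 4)) (G 0)).source,
      extChartAt (𝓡 4) (G 0) x ∈ ball (extChartAt (𝓡 4) (G 0) (G 0)) rJ →
        J' (extChartAt (𝓡 4) (G 0) x) =
          inTangentCoordinates (𝓡 4) (𝓡 4) (id : V → V) id (fun x => J x) (G 0) x :=
    fun x hx hxb => (hJ'c hxb).trans (hJcE x hx)
  -- ### localisation of the `C⁰`-convergence into the chart
  obtain ⟨ρ', hρ', hρ'ρ, hGsrc, husrc, hlim'⟩ :=
    exists_closedBall_tendstoUniformlyOn_euclid hι hG.continuous hρ hlim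
  -- a radius `R` with `φ (G (closedBall 0 R))` inside the half ball where `J' = Jc`
  have hcA : ContinuousAt (fun z => extChartAt (𝓡 4) (G 0) (G z)) 0 :=
    (continuousAt_extChartAt (I := 𝓡 4) (G 0)).comp_of_eq hG.continuous.continuousAt rfl
  have h0mem : (fun z => extChartAt (𝓡 4) (G 0) (G z)) 0 ∈
      ball (extChartAt (𝓡 4) (G 0) (G 0)) (rJ / 2) := mem_ball_self (half_pos hrJ)
  obtain ⟨ρ₁, hρ₁, hρ₁b⟩ := Metric.mem_nhds_iff.1
    (hcA.preimage_mem_nhds (isOpen_ball.mem_nhds h0mem))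
  set R : ℝ := min (ρ₁ / 2) ρ' with hRdef
  have hR : 0 < R := lt_min (half_pos hρ₁) hρ'
  have hRρ' : R ≤ ρ' := min_le_right _ _
  have hRρ₁ : closedBall (0 : ℂ) R ⊆ ball 0 ρ₁ :=
    closedBall_subset_ball ((min_le_left _ _).trans_lt (half_lt_self hρ₁))
  have hRρ : ball (0 : ℂ) R ⊆ ball 0 ρ := ball_subset_ball (hRρ'.trans hρ'ρ)
  have hGsrcR : ∀ z ∈ closedBall (0 : ℂ) R,
      G z ∈ (chartAt (EuclideanSpace ℝ (Fin 4)) (G 0)).source := fun z hz => by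
    rw [← extChartAt_source (𝓡 4)]
    exact hGsrc (closedBall_subset_closedBall hRρ' hz)
  have hGball : ∀ z ∈ closedBall (0 : ℂ) R,
      extChartAt (𝓡 4) (G 0) (G z) ∈ ball (extChartAt (𝓡 4) (G 0) (G 0)) (rJ / 2) :=
    fun z hz => hρ₁b (hRρ₁ hz)
  have hGball' : ∀ z ∈ closedBall (0 : ℂ) R,
      extChartAt (𝓡 4) (G 0) (G z) ∈ ball (extChartAt (𝓡 4) (G 0) (G 0)) rJ :=
    fun z hz => ball_subset_ball (half_le_self hrJ.le) (hGball z hz)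
  -- eventually the `uₙ` map `closedBall 0 R` into the chart domain and the same ball
  have hev : ∀ᶠ n in atTop, ∀ z ∈ closedBall (0 : ℂ) R,
      u n z ∈ (chartAt (EuclideanSpace ℝ (Fin 4)) (G 0)).source ∧
        extChartAt (𝓡 4) (G 0) (u n z) ∈ ball (extChartAt (𝓡 4) (G 0) (G 0)) rJ := by
    filter_upwards [husrc, Metric.tendstoUniformlyOn_iff.1 hlim' (rJ / 2) (half_pos hrJ)]
      with n hn hn' z hz
    have hz' : z ∈ closedBall (0 : ℂ) ρ' := closedBall_subset_closedBall hRρ' hz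
    refine ⟨?_, ?_⟩
    · rw [← extChartAt_source (𝓡 4)]
      exact hn hz'
    · have h1 := hGball z hz
      have h2 := hn' z hz'
      rw [mem_ball] at h1 ⊢
      calc dist (extChartAt (𝓡 4) (G 0) (u n z)) (extChartAt (𝓡 4) (G 0) (G 0))
          ≤ dist (extChartAt (𝓡 4) (G 0) (u n z)) (extChartAt (𝓡 4) (G 0) (G z)) +
              dist (extChartAt (𝓡 4) (G 0) (G z)) (extChartAt (𝓡 4) (G 0) (G 0)) :=
            dist_triangle _ _ _
        _ < rJ / 2 + rJ / 2 := add_lt_add (by rwa [dist_comm]) h1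
        _ = rJ := add_halves rJ
  obtain ⟨n₀, hn₀⟩ := eventually_atTop.1 hev
  have husrcR : ∀ n, ∀ z ∈ closedBall (0 : ℂ) R,
      u (n + n₀) z ∈ (chartAt (EuclideanSpace ℝ (Fin 4)) (G 0)).source :=
    fun n z hz => (hn₀ (n + n₀) (Nat.le_add_left n₀ n) z hz).1
  have huball : ∀ n, ∀ z ∈ closedBall (0 : ℂ) R,
      extChartAt (𝓡 4) (G 0) (u (n + n₀) z) ∈ ball (extChartAt (𝓡 4) (G 0) (G 0)) rJ :=
    fun n z hz => (hn₀ (n + n₀) (Nat.le_add_left n₀ n) z hz).2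
  -- ### the flat data
  have hfs : ContDiffOn ℝ ∞ (fun z => extChartAt (𝓡 4) (G 0) (G z)) (ball 0 R) := fun z hz =>
    (ChartLocalisation.contDiffAt_chart (hG z) (hGsrcR z (ball_subset_closedBall hz))).contDiffWithinAt
  have hfJ : ∀ z ∈ ball (0 : ℂ) R, ∀ ζ : ℂ,
      fderiv ℝ (fun z => extChartAt (𝓡 4) (G 0) (G z)) z (Complex.I * ζ) =
        J' (extChartAt (𝓡 4) (G 0) (G z))
          (fderiv ℝ (fun z => extChartAt (𝓡 4) (G 0) (G z)) z ζ) := fun z hz ζ => by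
    have hzS := hGsrcR z (ball_subset_closedBall hz)
    rw [ChartLocalisation.fderiv_chart_I_mul J (hG z) (hGJ z) hzS ζ,
      hJ'E (G z) hzS (hGball' z (ball_subset_closedBall hz))]
  have hf's : ∀ n, ContDiffOn ℝ ∞ (fun z => extChartAt (𝓡 4) (G 0) (u (n + n₀) z)) (ball 0 R) :=
    fun n z hz =>
    (ChartLocalisation.contDiffAt_chart (hu (n + n₀) z)
      (husrcR n z (ball_subset_closedBall hz))).contDiffWithinAt
  have hf'J : ∀ n, ∀ z ∈ ball (0 : ℂ) R, ∀ ζ : ℂ,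
      fderiv ℝ (fun z => extChartAt (𝓡 4) (G 0) (u (n + n₀) z)) z (Complex.I * ζ) =
        J' (extChartAt (𝓡 4) (G 0) (u (n + n₀) z))
          (fderiv ℝ (fun z => extChartAt (𝓡 4) (G 0) (u (n + n₀) z)) z ζ) := fun n z hz ζ => by
    have hzS := husrcR n z (ball_subset_closedBall hz)
    rw [ChartLocalisation.fderiv_chart_I_mul J (hu (n + n₀) z) (huJ (n + n₀) z) hzS ζ,
      hJ'E (u (n + n₀) z) hzS (huball n z (ball_subset_closedBall hz))]
  have hC0 : TendstoUniformlyOn (fun n z => extChartAt (𝓡 4) (G 0) (u (n + n₀) z))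
      (fun z => extChartAt (𝓡 4) (G 0) (G z)) atTop (ball 0 R) :=
    TendstoUniformlyOn.comp_tendsto_index
      (hlim'.mono (ball_subset_closedBall.trans (closedBall_subset_closedBall hRρ')))
      (tendsto_add_atTop_nat n₀)
  have hC1 := (hW J' hJ' hJ'2 (ball 0 R) isOpen_ball
    (fun n z => extChartAt (𝓡 4) (G 0) (u (n + n₀) z)) (fun z => extChartAt (𝓡 4) (G 0) (G z))
    hf's hf'J hC0.tendstoLocallyUniformlyOn).2.2
  refine ⟨J', fun z => extChartAt (𝓡 4) (G 0) (G z),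
    fun n z => extChartAt (𝓡 4) (G 0) (u (n + n₀) z), R, n₀, rfl, fun n z => rfl, hJ', hJ'2, hR,
    hRρ'.trans hρ'ρ, fun z hz => hGsrcR z (ball_subset_closedBall hz),
    fun n z hz => husrcR n z (ball_subset_closedBall hz), hfs, hfJ, ?_, ?_, ?_, hf's, hf'J, ?_, ?_,
    hC0, hC1⟩
  · -- `f` is injective on the disc: `φ` is injective on the chart domain, `G` on `ball 0 ρ`
    intro z hz w hw hzw
    have hzS : G z ∈ (extChartAt (𝓡 4) (G 0)).source := by
      rw [extChartAt_source]; exact hGsrcR z (ball_subset_closedBall hz)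
    have hwS : G w ∈ (extChartAt (𝓡 4) (G 0)).source := by
      rw [extChartAt_source]; exact hGsrcR w (ball_subset_closedBall hw)
    exact hGinj (hRρ hz) (hRρ hw) ((extChartAt (𝓡 4) (G 0)).injOn hzS hwS hzw)
  · -- `f` is immersive off `0`
    intro z hz hz0
    exact ChartLocalisation.injective_fderiv_chart (hG z) (hGsrcR z (ball_subset_closedBall hz))
      (hGimm z (hRρ hz) hz0)
  · -- `df(0) = 0`
    ext1 v
    rw [ChartLocalisation.fderiv_extChartAt_comp_apply (hG 0)
      (hGsrcR 0 (mem_closedBall_self hR.le)) v, h0, zero_apply]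
    exact map_zero _
  · -- the `f'ₙ` are immersions
    intro n z hz
    exact ChartLocalisation.injective_fderiv_chart (hu (n + n₀) z)
      (husrcR n z (ball_subset_closedBall hz)) (huimm (n + n₀) z)
  · -- the `f'ₙ` are injective on the disc
    intro n z hz w hw hzw
    have hzS : u (n + n₀) z ∈ (extChartAt (𝓡 4) (G 0)).source := by
      rw [extChartAt_source]; exact husrcR n z (ball_subset_closedBall hz)
    have hwS : u (n + n₀) w ∈ (extChartAt (𝓡 4) (G 0)).source := by
      rw [extChartAt_source]; exact husrcR n w (ball_subset_closedBall hw)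
    exact huinj (n + n₀) ((extChartAt (𝓡 4) (G 0)).injOn hzS hwS hzw)

/-- **`jHolomorphic_immersed_of_limitEmbedded_punctured` from its flat `C¹` core (McDuff 1991,
(5.6) with Cor. 4.4, Thm 1.4, Lemma 4.2(i)) and interior regularity (Hummel 1997, III.3.1).**
The hypothesis `hcusp` is the chart-level statement printed in McDuff, JDG 34 (1991), proof of
Thm 1.3 (5.6) p. 163: if `f : D → (ℝ⁴, J')` is `J'`-holomorphic and an embedding of the closed
disc `D = closedBall 0 r` except for the critical point `0` (`df(0) = 0`), then a `J'`-holomorphic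
immersion `f'` of `D` sufficiently `C¹`-close to `f` is not an embedding ("`Int(f') = L.Int(f, 0)`
so that `f'` is not an embedding": Cor. 4.4 p. 160 for the equality, Thm 1.4 p. 144 for
`L.Int(f, 0) > 0`, Lemma 4.2(i) p. 159 for "`Int` = number of double points of an immersion"),
here in sequential form (`f'ₙ → f` and `df'ₙ → df` uniformly on `D` ⇒ eventually `f'ₙ|D` is not
injective) and for maps `J'`-holomorphic on a neighbourhood `ball 0 R` of `D`. Given it, the named
fact follows from `exists_flatCuspData_of_mfderiv_eq_zero`: were `dG(0)` not injective it would
vanish (step 1), the chart expressions `f'ₙ` of the `u_{n+n₀}` would be `J'`-holomorphic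
immersions `C¹`-converging on `closedBall 0 (R/2)` to the chart expression `f` of `G`, an
embedding except at the critical point `0` — so some `f'ₙ` would fail to be injective there,
whereas every `uₙ` is injective. This is exactly McDuff's argument; the tree does not yet contain
her self-intersection number `Int` (Def. 4.1) and its properties, which is why `hcusp` is a
hypothesis here and the fact itself is not discharged in this file.
[cite: McDuff1991LocalBehaviour, (5.6) p. 163, Cor. 4.4, Thm 1.4, Lemma 4.2(i)] -/
theorem jHolomorphic_immersed_of_limitEmbedded_punctured_of_flat (hW : JHolomorphicWeierstrassR4)
    (hcusp : ∀ (J' : EuclideanSpace ℝ (Fin 4) → EuclideanSpace ℝ (Fin 4) →L[ℝ]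
        EuclideanSpace ℝ (Fin 4)), ContDiff ℝ ∞ J' → (∀ x v, J' x (J' x v) = -v) →
      ∀ (f : ℂ → EuclideanSpace ℝ (Fin 4)) (r R : ℝ), 0 < r → r < R →
        ContDiffOn ℝ ∞ f (ball 0 R) →
        (∀ z ∈ ball (0 : ℂ) R, ∀ ζ : ℂ,
          fderiv ℝ f z (Complex.I * ζ) = J' (f z) (fderiv ℝ f z ζ)) →
        InjOn f (closedBall 0 r) →
        (∀ z ∈ closedBall (0 : ℂ) r, z ≠ 0 → Injective (fderiv ℝ f z)) →
        fderiv ℝ f 0 = 0 →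
        ∀ f' : ℕ → ℂ → EuclideanSpace ℝ (Fin 4), (∀ n, ContDiffOn ℝ ∞ (f' n) (ball 0 R)) →
          (∀ n, ∀ z ∈ ball (0 : ℂ) R, ∀ ζ : ℂ,
            fderiv ℝ (f' n) z (Complex.I * ζ) = J' (f' n z) (fderiv ℝ (f' n) z ζ)) →
          (∀ n, ∀ z ∈ closedBall (0 : ℂ) r, Injective (fderiv ℝ (f' n) z)) →
          TendstoUniformlyOn f' f atTop (closedBall 0 r) →
          TendstoUniformlyOn (fun n => fderiv ℝ (f' n)) (fderiv ℝ f) atTop (closedBall 0 r) →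
          ∀ᶠ n in atTop, ¬ InjOn (f' n) (closedBall 0 r)) :
    jHolomorphic_immersed_of_limitEmbedded_punctured := by
  intro V _ _ _ _ _ J hJ2 hJsm N ι hι _hιs _hιimm G hG hGJ ρ hρ hGinj hGimm u hu huJ huinj huimm hlim
  by_contra hni
  have h0 := hGJ.mfderiv_eq_zero_of_not_injective hni
  obtain ⟨J', f, f', R, n₀, -, -, hJ', hJ'2, hR, -, -, -, hfs, hfJ, hfinj, hfimm, hf0, hf's, hf'J,
    hf'imm, hf'inj, hC0, hC1⟩ :=
    exists_flatCuspData_of_mfderiv_eq_zero hW hJ2 hJsm hι hG hGJ hρ hGinj hGimm h0 hu huJ huinj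
      huimm hlim
  have hsub : closedBall (0 : ℂ) (R / 2) ⊆ ball 0 R := closedBall_subset_ball (half_lt_self hR)
  have hd : TendstoUniformlyOn (fun n => fderiv ℝ (f' n)) (fderiv ℝ f) atTop
      (closedBall 0 (R / 2)) :=
    (tendstoLocallyUniformlyOn_iff_forall_isCompact isOpen_ball).1 hC1 _ hsub
      (isCompact_closedBall _ _)
  have key := hcusp J' hJ' hJ'2 f (R / 2) R (half_pos hR) (half_lt_self hR) hfs hfJ
    (hfinj.mono hsub) (fun z hz hz0 => hfimm z (hsub hz) hz0) hf0 f' hf's hf'J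
    (fun n z hz => hf'imm n z (hsub hz)) (hC0.mono hsub) hd
  obtain ⟨n, hn⟩ := key.exists
  exact hn ((hf'inj n).mono hsub)

end FlatCuspData

/-! ### Unique continuation from an open set (`jHolomorphic_uniqueContinuation_const`) -/

section UniqueContinuation

/-- **McDuff's unique continuation lemma, discharged** (McDuff, JDG 34 (1991), Lemma 2.3;
special case of an entire `J`-curve constant near a point). Proof by Carleman's weighted `L²`
method for `∂ₓ + J∂_y`: the set where `G` is locally constant is open, and closed by the chart
reduction `JHolomorphicUCP.eventuallyEq_of_mem_closure`
(`Literature/Geometry/Symplectic/JHolomorphicUniqueContinuationChart.lean`, resting on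
`Literature/Analysis/PDE/DbarWeakUniqueContinuation.lean`); `ℂ` is connected.
[cite: McDuff1991LocalBehaviour, Lemma 2.3] -/
theorem jHolomorphic_uniqueContinuation_const_holds : jHolomorphic_uniqueContinuation_const := by
  intro V _ _ _ _ _ J hJ2 hJs G hG hGJ z₀ hz₀
  set p := G z₀ with hp
  set A : Set ℂ := {z : ℂ | ∀ᶠ w in 𝓝 z, G w = p} with hA_def
  have hAopen : IsOpen A := isOpen_setOf_eventually_nhds
  have hz₀A : z₀ ∈ A := hz₀
  have hAclosed : IsClosed A := by
    refine isClosed_of_closure_subset fun z₁ hz₁ => ?_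
    exact JHolomorphicUCP.eventuallyEq_of_mem_closure V J hJ2 hJs G hG hGJ p z₁ hz₁
  have hAuniv : A = univ := by
    rcases isClopen_iff.mp ⟨hAclosed, hAopen⟩ with h | h
    · exact absurd hz₀A (by rw [h]; exact notMem_empty z₀)
    · exact h
  intro z
  have hz : z ∈ A := by rw [hAuniv]; exact mem_univ z
  exact (show ∀ᶠ w in 𝓝 z, G w = p from hz).self_of_nhds

end UniqueContinuation

end Literature.Geometry.Symplectic
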